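/-
Copyright (c) 2026 the pub-hodgecm-mathlib formalisation cell (harness21).  Prover seat hodgecm-mathlib-K2E4-p14 (g7): Track B «K2-LIT», ENGINE E1,
h413 = stmt-HodgeConjecture-24833; DEAL (23)∕RULING (31) of K2E1-plan (g6), FILE 1 §1 (β): «EVERY-PLACE LOCAL INTEGRABILITY OF THE `U(2,1)` INTERTWINING INTEGRAND».
-/
import Summits.HodgeConjecture.HodgeConjecture.Theorems.K2E1IntertwiningLocalMeanCMU3                 -- ★ (3-iii-b1) (K2E2-p12 g5): the CM token `Q_v`, good-place integrability; brings ★ LocalHeightU3, LocalMeanSplitU3, GK, BigCellCoordinateChangeGL3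
import Summits.HodgeConjecture.HodgeConjecture.Theorems.K2E1IntertwiningLocalFactorU2                   -- ★ N = 2 FILE 2: `integrable_max_one_normAbs_rpow_neg` (Tate's `∫ max(1,|t|)^{−s} < ∞`, `s > 1`)
import Summits.HodgeConjecture.HodgeConjecture.Theorems.K2E3U2DiscrInvFourthRootLocallyIntegrable        -- ★ (K2E3 lineage): `normAbs_toPlace_eq_sq` (`|ι y|_w = |y|_v²` at a NON-SPLIT place, any ramification)
import Literature.NumberTheory.Automorphic.HeisenbergChartAtNonsplitPlace                              -- ★ `valued_conjLocal_apply_of_smul_eq` (`|σx|_w = |x|_w` at a non-split place)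
import Literature.NumberTheory.Automorphic.AddCharConductorExponent                                    -- ★ `normAbs_add_le_max`, `normAbs_neg`, `normAbs_le_normAbs_iff_valued`
import HarnessLib

/-!
# K2·E1 — `K2E1IntertwiningLocalFactorIntegrableU3` (DEAL (23)∕(31) FILE 1 §1 (β)): THE LOCAL FACTOR `Q_v^{−σ}` OF THE `U(2,1)` INTERTWINING CONSTANT IS `ν_v³`-INTEGRABLE AT
# EVERY FINITE PLACE `v` OF `L⁺` — SPLIT `v`: `σ > 1` (Gindikin–Karpelevich after the general-Jacobian big-cell change); NON-SPLIT `v`: `σ > 3∕2` (crude ultrametric bound) —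
# NO GOODNESS HYPOTHESIS (`v ∣ 2`, `δ` a non-unit, `v` ramified all allowed): the bad places `S₀` of ★ FILE 3′ at the pole `σ = 2`

Track B ∕ K2-LIT, crux h413 = `stmt-HodgeConjecture-24833`, route of record `HCCMUnconditional`; cell `hodgecm-mathlib`, squad K2, ENGINE E1 (campaign «EIS-RANK-ONE», R7 at `N = 3`,
(R-b)₃ letter-free).  THEOREMS ONLY (no `def`, no instance, no notation, no named-fact hypothesis, no `sorry`; default heartbeats); lane `--supports stmt-HodgeConjecture-24833 --as helper`
(count-neutral).  CM pair `L ∕ L⁺`, `c` = complex conjugation, `δ ∈ L⁻ ∖ 0`, `δ² = d`.  TOKEN (★ `K2E1IntertwiningLocalMeanCMU3`, ★ FILE 3′ verbatim): with `X = Ψ_v(p₀,p₁) ∈ L ⊗ L⁺_v`,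
`Z = ι(p₂)·δ − ι(½)·X·σX`:  `Q_v(p) = ∏_{w' ∣ v} max(1, ‖X_{w'}‖, ‖Z_{w'}‖)`.

THE MATHEMATICS [Langlands1971, §3; MoeglinWaldspurger1995, II.1.7, IV.1.11; TateThesis1967, §3.3].
* SPLIT `v` (§1–§2): `Q_v(p)^{−σ} = G(Φ_{δ_w} p)`, `G = (max(1,|x|,|z|)·max(1,|y|,|z−xy|))^{−σ}` the Gindikin–Karpelevich integrand, `Φ_{δ₁}(a,b,t) = (a + δ₁b, −(a − δ₁b), δ₁t − ½(a+δ₁b)(a−δ₁b))`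
  (★ `localHeight_rpow_eq_gl3_of_split`); `Φ_{δ₁} = S ∘ M`, `S` a Haar-preserving shear (★ `measurePreserving_shear_fin_three`), `M` LINEAR, `det M = 2δ₁² ≠ 0`, so `(ν³)∘M⁻¹ = ‖2δ₁²‖⁻¹·ν³`
  (★ `map_linearEquiv_addHaar`): `G ∘ Φ_{δ₁} ∈ L¹(ν³)` for `σ > 1` from ★ `integrable_gkCell_pi` with NO unit hypothesis on `2`, `δ₁` (★ (3-ii) needed units only for the EXACT local mean).
* NON-SPLIT `v` (§3–§4; one place `w`, `σ•w = w`, any ramification): `X ± σX = ι(2p₀), ι(2p₁)δ`, `Z − σZ = ι(2p₂)δ` (★ `conjLocal_quadraticLocalEquiv`), `|σy|_w = |y|_w` (★), the ultrametric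
  inequality and `|ι y|_w = |y|_v²` (★ `normAbs_toPlace_eq_sq`) give `Q_v(p) ≥ max(1, κ|p_i|_v²)`, `κ = |2|_v²·min(1,|δ|_w) > 0`; hence `Q_v^{−σ} ≤ min(1,κ)^{−σ}·∏_i max(1,|p_i|)^{−2σ∕3}`,
  integrable for `2σ∕3 > 1` (★ `integrable_max_one_normAbs_rpow_neg`, `Integrable.fintype_prod`).
* HEADS: **`integrable_localHeight_rpow_of_split_cm`** (`σ > 1`), **`…_of_nonsplit_cm`** (`σ > 3∕2`), **`integrable_localHeight_rpow_cm`** (every `v`, `σ > 3∕2`) and the `σ`-uniform bound in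
  `ℂ`-currency **`norm_localMean_le_cm`**: for `3∕2 < σ₀ ≤ σ`, `‖(ν³(𝒪³))⁻¹ • ∫ ((Q_v^{−σ} : ℝ) : ℂ) dν³‖ ≤ (ν³(𝒪³))⁻¹·∫ Q_v^{−σ₀} dν³`.
HONEST LABEL: HC_CM is proved only modulo the 7 printed citations (2 remaining named inputs: hLiu418 = `stmt-HodgeConjecture-24832`, h413 = `stmt-HodgeConjecture-24833`) until rung 0
closes; this file asserts no named fact and closes no socket; count-neutral; unconditional local analysis.

## References
* [Langlands1971] R. P. Langlands, *Euler Products* (1971): §3.  [MoeglinWaldspurger1995] C. Mœglin, J.-L. Waldspurger, *Spectral Decomposition and Eisenstein Series* (1995): II.1.7.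
* [TateThesis1967] J. Tate, *Fourier analysis in number fields and Hecke's zeta-functions* (1967): §3.3.
-/

set_option autoImplicit false
set_option linter.dupNamespace false -- the mandated namespace repeats `HodgeConjecture.HodgeConjecture`

noncomputable section

open MeasureTheory MeasureTheory.Measure NumberField IsDedekindDomain Filter Matrix
open scoped NNReal ENNReal
open Literature.NumberTheory.Automorphic Literature.NumberTheory.Automorphic.UnitaryGroup Literature.NumberTheory.GaloisRepresentations
open Literature.NumberTheory.GaloisRepresentations.IsNonarchimedeanLocalField
open Literature.NumberTheory.Automorphic.LocalFieldHaar
open Literature.NumberTheory.GelbartRogawski1991.UnitaryDualPair.LocalSplitting (splitSqrt splitSqrt_ne_zero)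
open Summit.HodgeConjecture.HodgeConjecture.Cruxes.H413.K2E1IntertwiningLocalHeightU3 (continuous_localHeight_rpow localHeight_rpow_eq_gl3_of_split)
open Summit.HodgeConjecture.HodgeConjecture.Cruxes.H413.K2E1IntertwiningLocalMeanSplitU3 (integrable_gkCell_pi continuous_gkCell mul_rpow_neg_max_one)
open Summit.HodgeConjecture.HodgeConjecture.Cruxes.H413.K2E1BigCellCoordinateChangeGL3 (measurePreserving_shear_fin_three det_bigCellMatrix bigCellMatrix_mulVec)
open Summit.HodgeConjecture.HodgeConjecture.Cruxes.H413.K2E1IntertwiningLocalFactorU2 (integrable_max_one_normAbs_rpow_neg)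

namespace Summit.HodgeConjecture.HodgeConjecture.Cruxes.H413.K2E1IntertwiningLocalFactorIntegrableU3

/-! ## §1 Generic local field: the Gindikin–Karpelevich integrand after the big-cell change with ANY `δ₁ ≠ 0` -/

section Generic

variable {F : Type*} [Field F] [ValuativeRel F] [TopologicalSpace F] [IsNonarchimedeanLocalField F]
  [MeasurableSpace F] [BorelSpace F] (μ : Measure F) [μ.IsAddHaarMeasure]

/-- **Linear change with NON-ZERO determinant**: if `G ∈ L¹(μ^3)` then `G ∘ (M·) ∈ L¹(μ^3)` for every `M` with `det M ≠ 0` — `(μ³).map (M·) = mod_F(det M)⁻¹ • μ³`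
(★ `map_linearEquiv_addHaar`), a finite multiple. [cite: TateThesis1967, §3.3] -/
theorem integrable_comp_mulVec_of_det_ne_zero (M : Matrix (Fin 3) (Fin 3) F) (hM : M.det ≠ 0) {G : (Fin 3 → F) → ℝ}
    (hG : Integrable G (Measure.pi fun _ : Fin 3 => μ)) (hGc : Continuous G) :
    Integrable (fun p : Fin 3 → F => G (M *ᵥ p)) (Measure.pi fun _ : Fin 3 => μ) := by
  haveI := secondCountableTopology_localField F; haveI := sigmaCompactSpace_of_isNonarchimedeanLocalField F
  set L : (Fin 3 → F) ≃ₗ[F] (Fin 3 → F) := Matrix.toLinearEquiv' M (Matrix.invertibleOfIsUnitDet M (Ne.isUnit hM)) with hL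
  have hLM : (fun p : Fin 3 → F => M *ᵥ p) = (L : (Fin 3 → F) → (Fin 3 → F)) := funext fun p => rfl
  have hmeas : Measurable (L : (Fin 3 → F) → (Fin 3 → F)) := by
    rw [← hLM]
    refine (continuous_pi fun i => ?_).measurable
    simp only [Matrix.mulVec, dotProduct]
    exact continuous_finsetSum _ fun j _ => continuous_const.mul (continuous_apply j)
  have hG' : Integrable G ((Measure.pi fun _ : Fin 3 => μ).map L) := by
    rw [Literature.MeasureTheory.Group.map_linearEquiv_addHaar (Measure.pi fun _ : Fin 3 => μ) L]
    exact hG.smul_measure_nnreal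
  have h := (integrable_map_measure hGc.aestronglyMeasurable hmeas.aemeasurable).1 hG'
  simpa only [Function.comp_def, ← hLM] using h

/-- **`G ∘ Φ_{δ₁} ∈ L¹(μ³)` FOR EVERY `δ₁ ≠ 0`, `2 ≠ 0` AND `σ > 1`**, `G` the Gindikin–Karpelevich integrand, `Φ_{δ₁}(a,b,t) = (a + δ₁b, −(a − δ₁b), δ₁t − ½(a+δ₁b)(a−δ₁b))`:
`Φ_{δ₁} = S ∘ M` (★ `bigCellMatrix_mulVec`; `det M = 2δ₁²` ★ `det_bigCellMatrix`), `S` the Haar-preserving shear ★ `measurePreserving_shear_fin_three`, `G ∈ L¹` ★ `integrable_gkCell_pi`.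
[cite: Langlands1971, §3] [cite: TateThesis1967, §3.3] -/
theorem integrable_gkCell_comp_bigCellChange {δ₁ : F} (hδ₁ : δ₁ ≠ 0) (h2 : (2 : F) ≠ 0) {σ : ℝ} (hσ : 1 < σ) :
    Integrable (fun p : Fin 3 → F =>
      (fun q : Fin 3 → F => (max 1 (max ((normAbs F (q 0) : ℝ≥0) : ℝ) ((normAbs F (q 2) : ℝ≥0) : ℝ))) ^ (-σ) *
        (max 1 (max ((normAbs F (q 1) : ℝ≥0) : ℝ) ((normAbs F (q 2 - q 0 * q 1) : ℝ≥0) : ℝ))) ^ (-σ))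
        ![p 0 + δ₁ * p 1, -(p 0 - δ₁ * p 1), δ₁ * p 2 - 2⁻¹ * (p 0 + δ₁ * p 1) * (p 0 - δ₁ * p 1)]) (Measure.pi fun _ : Fin 3 => μ) := by
  haveI := secondCountableTopology_localField F
  -- the shear `S p = update p 2 (p 2 + ½ p₀ p₁)` preserves `μ³`, so `G ∘ S ∈ L¹`
  have hφ : Measurable (Function.uncurry fun x y : F => 2⁻¹ * x * y) :=
    ((measurable_const.mul measurable_fst).mul measurable_snd)
  have hS := measurePreserving_shear_fin_three μ hφ
  have hGS : Integrable (fun q : Fin 3 → F => (fun q : Fin 3 → F => (max 1 (max ((normAbs F (q 0) : ℝ≥0) : ℝ) ((normAbs F (q 2) : ℝ≥0) : ℝ))) ^ (-σ) *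
        (max 1 (max ((normAbs F (q 1) : ℝ≥0) : ℝ) ((normAbs F (q 2 - q 0 * q 1) : ℝ≥0) : ℝ))) ^ (-σ)) (Function.update q 2 (q 2 + 2⁻¹ * q 0 * q 1))) (Measure.pi fun _ : Fin 3 => μ) :=
    hS.integrable_comp_of_integrable (integrable_gkCell_pi μ hσ)
  -- continuity of `G ∘ S`
  have hSc : Continuous fun q : Fin 3 → F => Function.update q 2 (q 2 + 2⁻¹ * q 0 * q 1) := by
    refine continuous_pi fun i => ?_
    by_cases hi : i = 2
    · subst hi
      simp only [Function.update_self]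
      exact (continuous_apply 2).add ((continuous_const.mul (continuous_apply 0)).mul (continuous_apply 1))
    · simp only [Function.update_of_ne hi]
      exact continuous_apply i
  have hGSc : Continuous fun q : Fin 3 → F => (fun q : Fin 3 → F => (max 1 (max ((normAbs F (q 0) : ℝ≥0) : ℝ) ((normAbs F (q 2) : ℝ≥0) : ℝ))) ^ (-σ) *
        (max 1 (max ((normAbs F (q 1) : ℝ≥0) : ℝ) ((normAbs F (q 2 - q 0 * q 1) : ℝ≥0) : ℝ))) ^ (-σ)) (Function.update q 2 (q 2 + 2⁻¹ * q 0 * q 1)) :=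
    (continuous_gkCell (F := F) σ).comp hSc
  -- the linear part
  have hM : (!![(1 : F), δ₁, 0; -1, δ₁, 0; 0, 0, δ₁]).det ≠ 0 := by
    rw [det_bigCellMatrix]
    exact mul_ne_zero h2 (pow_ne_zero 2 hδ₁)
  have h := integrable_comp_mulVec_of_det_ne_zero μ _ hM hGS hGSc
  have hvec : ∀ p : Fin 3 → F, Function.update (!![(1 : F), δ₁, 0; -1, δ₁, 0; 0, 0, δ₁] *ᵥ p) 2
      ((!![(1 : F), δ₁, 0; -1, δ₁, 0; 0, 0, δ₁] *ᵥ p) 2 + 2⁻¹ * (!![(1 : F), δ₁, 0; -1, δ₁, 0; 0, 0, δ₁] *ᵥ p) 0 * (!![(1 : F), δ₁, 0; -1, δ₁, 0; 0, 0, δ₁] *ᵥ p) 1) =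
      ![p 0 + δ₁ * p 1, -(p 0 - δ₁ * p 1), δ₁ * p 2 - 2⁻¹ * (p 0 + δ₁ * p 1) * (p 0 - δ₁ * p 1)] := by
    intro p
    rw [bigCellMatrix_mulVec]
    ext i
    fin_cases i <;> simp
    ring
  refine h.congr (Eventually.of_forall fun p => ?_)
  simp only [hvec]

end Generic

/-! ## §2 The CM pair: split places (`σ > 1`, any badness) -/
variable (L : Type) [Field L] [NumberField L] [IsCMField L] {δ : L} (hcδ : IsCMField.complexConj L δ = -δ) (hδ : δ ≠ 0)
  {d : ↥(maximalRealSubfield L)} (hd : δ * δ = algebraMap ↥(maximalRealSubfield L) L d)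
  (v : HeightOneSpectrum (𝓞 ↥(maximalRealSubfield L)))

section Places

variable [MeasurableSpace (v.adicCompletion ↥(maximalRealSubfield L))] [BorelSpace (v.adicCompletion ↥(maximalRealSubfield L))]
  (ν : Measure (v.adicCompletion ↥(maximalRealSubfield L))) [ν.IsAddHaarMeasure]

include hd in
/-- **INTEGRABILITY OF `Q_v^{−σ}` AT A SPLIT PLACE, NO UNIT HYPOTHESIS** (`σ > 1`): ★ `localHeight_rpow_eq_gl3_of_split` + §1 at `δ₁ = δ_w = splitSqrt ≠ 0` (★ `splitSqrt_ne_zero`).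
[cite: Langlands1971, §3] [cite: TateThesis1967, §3.3] -/
theorem integrable_localHeight_rpow_of_split_cm (w : PlacesOver L v) (hw : IsCMField.complexConj L • w.1 ≠ w.1) {σ : ℝ} (hσ : 1 < σ) :
    Integrable (fun p : Fin 3 → v.adicCompletion ↥(maximalRealSubfield L) =>
        (∏ w' : PlacesOver L v, max 1 (max ((normAbs (w'.1.adicCompletion L) (quadraticLocalEquiv L v (IsCMField.complexConj L) hcδ hδ (p 0, p 1) w') : ℝ≥0) : ℝ)
          ((normAbs (w'.1.adicCompletion L) ((toLocalRing L v (p 2) * algebraMap L (LocalRing L v) δ -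
            toLocalRing L v 2⁻¹ * (quadraticLocalEquiv L v (IsCMField.complexConj L) hcδ hδ (p 0, p 1) *
              conjLocal L (IsCMField.complexConj L) v (quadraticLocalEquiv L v (IsCMField.complexConj L) hcδ hδ (p 0, p 1)))) w') : ℝ≥0) : ℝ))) ^ (-σ))
      (Measure.pi fun _ : Fin 3 => ν) := by
  haveI : Algebra.IsQuadraticExtension ↥(maximalRealSubfield L) L := IsCMField.isQuadraticExtension L
  have hδ₁ : splitSqrt ↥(maximalRealSubfield L) L (IsCMField.complexConj L) hcδ hδ v w ≠ 0 :=
    splitSqrt_ne_zero ↥(maximalRealSubfield L) L (IsCMField.complexConj L) hcδ hδ hd v w hw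
  refine (integrable_gkCell_comp_bigCellChange ν hδ₁ two_ne_zero hσ).congr (Filter.Eventually.of_forall fun p => ?_)
  beta_reduce
  rw [localHeight_rpow_eq_gl3_of_split L (IsCMField.complexConj L) hcδ hδ hd v w hw σ p, mul_rpow_neg_max_one (le_max_left _ _) (le_max_left _ _)]
  simp only [Matrix.cons_val_zero, Matrix.cons_val_one, Matrix.cons_val_two, Matrix.head_cons, Matrix.tail_cons]

/-! ## §3 The CM pair: the crude lower bound at a non-split place -/
omit [MeasurableSpace (v.adicCompletion ↥(maximalRealSubfield L))] [BorelSpace (v.adicCompletion ↥(maximalRealSubfield L))] in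
/-- **`‖X_w‖ ≥ ‖2‖_v²·‖p₀‖_v²` and `‖X_w‖ ≥ ‖2‖_v²·‖p₁‖_v²·‖δ‖_w` at a non-split place** (`X = Ψ_v(p₀,p₁)`): `X + σX = ι(2p₀)`, `X − σX = ι(2p₁)·δ` (★ `conjLocal_quadraticLocalEquiv`),
`|σX|_w = |X|_w` (★), ultrametric inequality, `|ι y|_w = |y|_v²` (★ `normAbs_toPlace_eq_sq`). [cite: MoeglinWaldspurger1995, II.1.7] -/
theorem normAbs_quadraticLocalEquiv_lower (w : PlacesOver L v) (hw : IsCMField.complexConj L • w.1 = w.1) (a b : v.adicCompletion ↥(maximalRealSubfield L)) :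
    normAbs (v.adicCompletion ↥(maximalRealSubfield L)) 2 ^ 2 * normAbs (v.adicCompletion ↥(maximalRealSubfield L)) a ^ 2 ≤
        normAbs (w.1.adicCompletion L) (quadraticLocalEquiv L v (IsCMField.complexConj L) hcδ hδ (a, b) w) ∧
      normAbs (v.adicCompletion ↥(maximalRealSubfield L)) 2 ^ 2 * normAbs (v.adicCompletion ↥(maximalRealSubfield L)) b ^ 2 * normAbs (w.1.adicCompletion L) (algebraMap L (LocalRing L v) δ w) ≤
        normAbs (w.1.adicCompletion L) (quadraticLocalEquiv L v (IsCMField.complexConj L) hcδ hδ (a, b) w) := by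
  haveI : Algebra.IsQuadraticExtension ↥(maximalRealSubfield L) L := IsCMField.isQuadraticExtension L
  set X := quadraticLocalEquiv L v (IsCMField.complexConj L) hcδ hδ (a, b) with hX
  have hσX : conjLocal L (IsCMField.complexConj L) v X = quadraticLocalEquiv L v (IsCMField.complexConj L) hcδ hδ (a, -b) := conjLocal_quadraticLocalEquiv L v _ hcδ hδ a b
  -- norms of the conjugate at `w`
  have hnσ : normAbs (w.1.adicCompletion L) (conjLocal L (IsCMField.complexConj L) v X w) = normAbs (w.1.adicCompletion L) (X w) :=
    le_antisymm ((normAbs_le_normAbs_iff_valued w.1 _ _).2 (valued_conjLocal_apply_of_smul_eq L v w hw X).le)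
      ((normAbs_le_normAbs_iff_valued w.1 _ _).2 (valued_conjLocal_apply_of_smul_eq L v w hw X).ge)
  -- `X + σX = ι(2a)`, `X - σX = ι(2b)·δ`
  have hsum : X + conjLocal L (IsCMField.complexConj L) v X = toLocalRing L v (2 * a) := by
    rw [hσX, hX, quadraticLocalEquiv_apply, quadraticLocalEquiv_apply]
    simp only [map_mul, map_neg, map_ofNat]
    ring
  have hdiff : X - conjLocal L (IsCMField.complexConj L) v X = toLocalRing L v (2 * b) * algebraMap L (LocalRing L v) δ := by
    rw [hσX, hX, quadraticLocalEquiv_apply, quadraticLocalEquiv_apply]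
    simp only [map_mul, map_neg, map_ofNat]
    ring
  have hι : ∀ y : v.adicCompletion ↥(maximalRealSubfield L), normAbs (w.1.adicCompletion L) (toLocalRing L v y w) = normAbs (v.adicCompletion ↥(maximalRealSubfield L)) y ^ 2 := fun y => by
    rw [toLocalRing_apply]
    exact K2E3U2DiscrInvFourthRootLocallyIntegrable.normAbs_toPlace_eq_sq L v w hw y
  refine ⟨?_, ?_⟩
  · have h := normAbs_add_le_max (F := w.1.adicCompletion L) (X w) (conjLocal L (IsCMField.complexConj L) v X w)
    rw [hnσ, max_self, ← Pi.add_apply, hsum, hι, map_mul, mul_pow] at h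
    exact h
  · have h := normAbs_add_le_max (F := w.1.adicCompletion L) (X w) (-(conjLocal L (IsCMField.complexConj L) v X w))
    rw [normAbs_neg, hnσ, max_self, ← sub_eq_add_neg, ← Pi.sub_apply, hdiff, Pi.mul_apply, map_mul, hι, map_mul, mul_pow] at h
    exact h

omit [MeasurableSpace (v.adicCompletion ↥(maximalRealSubfield L))] [BorelSpace (v.adicCompletion ↥(maximalRealSubfield L))] in
/-- **`‖Z_w‖ ≥ ‖2‖_v²·‖p₂‖_v²·‖δ‖_w` at a non-split place** (`Z = ι(p₂)·δ − ι(½)·X·σX`): `Z − σZ = ι(2p₂)·δ` (`σ` fixes `ι(L⁺_v)` and `X·σX`, negates `δ`).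
[cite: MoeglinWaldspurger1995, II.1.7] -/
theorem normAbs_corner_lower (w : PlacesOver L v) (hw : IsCMField.complexConj L • w.1 = w.1) (a b t : v.adicCompletion ↥(maximalRealSubfield L)) :
    normAbs (v.adicCompletion ↥(maximalRealSubfield L)) 2 ^ 2 * normAbs (v.adicCompletion ↥(maximalRealSubfield L)) t ^ 2 * normAbs (w.1.adicCompletion L) (algebraMap L (LocalRing L v) δ w) ≤
      normAbs (w.1.adicCompletion L) ((toLocalRing L v t * algebraMap L (LocalRing L v) δ -
        toLocalRing L v 2⁻¹ * (quadraticLocalEquiv L v (IsCMField.complexConj L) hcδ hδ (a, b) *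
          conjLocal L (IsCMField.complexConj L) v (quadraticLocalEquiv L v (IsCMField.complexConj L) hcδ hδ (a, b)))) w) := by
  haveI : Algebra.IsQuadraticExtension ↥(maximalRealSubfield L) L := IsCMField.isQuadraticExtension L
  set X := quadraticLocalEquiv L v (IsCMField.complexConj L) hcδ hδ (a, b) with hX
  set Z := toLocalRing L v t * algebraMap L (LocalRing L v) δ - toLocalRing L v 2⁻¹ * (X * conjLocal L (IsCMField.complexConj L) v X) with hZ
  have hσX : conjLocal L (IsCMField.complexConj L) v X = quadraticLocalEquiv L v (IsCMField.complexConj L) hcδ hδ (a, -b) := conjLocal_quadraticLocalEquiv L v _ hcδ hδ a b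
  have hσσX : conjLocal L (IsCMField.complexConj L) v (conjLocal L (IsCMField.complexConj L) v X) = X := by
    rw [hσX, conjLocal_quadraticLocalEquiv L v _ hcδ hδ a (-b), neg_neg]
  have hσZ : conjLocal L (IsCMField.complexConj L) v Z = -(toLocalRing L v t * algebraMap L (LocalRing L v) δ) - toLocalRing L v 2⁻¹ * (X * conjLocal L (IsCMField.complexConj L) v X) := by
    rw [hZ, map_sub, map_mul, map_mul, map_mul, conjLocal_toLocalRing, conjLocal_toLocalRing, conjLocal_algebraMap, hcδ, map_neg, hσσX]
    ring
  have hdiff : Z - conjLocal L (IsCMField.complexConj L) v Z = toLocalRing L v (2 * t) * algebraMap L (LocalRing L v) δ := by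
    rw [hσZ, hZ, map_mul, map_ofNat]
    ring
  have hnσ : normAbs (w.1.adicCompletion L) (conjLocal L (IsCMField.complexConj L) v Z w) = normAbs (w.1.adicCompletion L) (Z w) :=
    le_antisymm ((normAbs_le_normAbs_iff_valued w.1 _ _).2 (valued_conjLocal_apply_of_smul_eq L v w hw Z).le)
      ((normAbs_le_normAbs_iff_valued w.1 _ _).2 (valued_conjLocal_apply_of_smul_eq L v w hw Z).ge)
  have hι : ∀ y : v.adicCompletion ↥(maximalRealSubfield L), normAbs (w.1.adicCompletion L) (toLocalRing L v y w) = normAbs (v.adicCompletion ↥(maximalRealSubfield L)) y ^ 2 := fun y => by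
    rw [toLocalRing_apply]
    exact K2E3U2DiscrInvFourthRootLocallyIntegrable.normAbs_toPlace_eq_sq L v w hw y
  have h := normAbs_add_le_max (F := w.1.adicCompletion L) (Z w) (-(conjLocal L (IsCMField.complexConj L) v Z w))
  rw [normAbs_neg, hnσ, max_self, ← sub_eq_add_neg, ← Pi.sub_apply, hdiff, Pi.mul_apply, map_mul, hι, map_mul, mul_pow] at h
  exact h

omit [MeasurableSpace (v.adicCompletion ↥(maximalRealSubfield L))] [BorelSpace (v.adicCompletion ↥(maximalRealSubfield L))] in
/-- `max(1, κ‖y‖²)^{−s} ≤ min(1,κ)^{−s}·max(1,‖y‖)^{−2s}` for `κ > 0`, `s ≥ 0` (`min(1,κ)·max(1,‖y‖)² ≤ max(1, κ‖y‖²)`). [folklore] -/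
theorem max_one_mul_sq_rpow_neg_le {κ s y : ℝ} (hκ : 0 < κ) (hs : 0 ≤ s) :
    (max 1 (κ * y ^ 2)) ^ (-s) ≤ (min 1 κ) ^ (-s) * (max 1 y) ^ (-(2 * s)) := by
  have hmin : 0 < min 1 κ := lt_min one_pos hκ
  have hmax : 1 ≤ max 1 y := le_max_left _ _
  have hle : min 1 κ * (max 1 y) ^ 2 ≤ max 1 (κ * y ^ 2) := by
    rcases le_total y 1 with h | h
    · rw [max_eq_left h]
      nlinarith [min_le_left (1 : ℝ) κ, le_max_left (1 : ℝ) (κ * y ^ 2)]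
    · rw [max_eq_right h]
      nlinarith [min_le_right (1 : ℝ) κ, le_max_right (1 : ℝ) (κ * y ^ 2), sq_nonneg y, mul_le_mul_of_nonneg_right (min_le_right (1 : ℝ) κ) (sq_nonneg y)]
  calc (max 1 (κ * y ^ 2)) ^ (-s) ≤ (min 1 κ * (max 1 y) ^ 2) ^ (-s) :=
        Real.rpow_le_rpow_of_nonpos (by positivity) hle (by linarith)
    _ = (min 1 κ) ^ (-s) * (max 1 y) ^ (-(2 * s)) := by
        rw [Real.mul_rpow hmin.le (by positivity), show (-(2 * s) : ℝ) = (2 : ℕ) * (-s) by push_cast; ring, Real.rpow_natCast_mul (by positivity)]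

omit [MeasurableSpace (v.adicCompletion ↥(maximalRealSubfield L))] [BorelSpace (v.adicCompletion ↥(maximalRealSubfield L))] in
/-- **THE CRUDE MAJORANT AT A NON-SPLIT PLACE**: with `κ = ‖2‖_v²·min(1, ‖δ‖_w) > 0`, for every `σ ≥ 0`,
`Q_v(p)^{−σ} ≤ min(1,κ)^{−σ} · ∏_{i<3} max(1, ‖p_i‖_v)^{−2σ∕3}` (`Q_v ≥ max(1, κ‖p_i‖²)` for each `i`, so `Q_v³ ≥ ∏_i max(1, κ‖p_i‖²)`). [cite: MoeglinWaldspurger1995, II.1.7] -/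
theorem localHeight_rpow_le_of_nonsplit (w : PlacesOver L v) (hw : IsCMField.complexConj L • w.1 = w.1) {σ : ℝ} (hσ : 0 ≤ σ)
    (p : Fin 3 → v.adicCompletion ↥(maximalRealSubfield L)) :
    (∏ w' : PlacesOver L v, max 1 (max ((normAbs (w'.1.adicCompletion L) (quadraticLocalEquiv L v (IsCMField.complexConj L) hcδ hδ (p 0, p 1) w') : ℝ≥0) : ℝ)
          ((normAbs (w'.1.adicCompletion L) ((toLocalRing L v (p 2) * algebraMap L (LocalRing L v) δ -
            toLocalRing L v 2⁻¹ * (quadraticLocalEquiv L v (IsCMField.complexConj L) hcδ hδ (p 0, p 1) *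
              conjLocal L (IsCMField.complexConj L) v (quadraticLocalEquiv L v (IsCMField.complexConj L) hcδ hδ (p 0, p 1)))) w') : ℝ≥0) : ℝ))) ^ (-σ) ≤
      (min 1 ((normAbs (v.adicCompletion ↥(maximalRealSubfield L)) 2 ^ 2 * min 1 (normAbs (w.1.adicCompletion L) (algebraMap L (LocalRing L v) δ w)) : ℝ≥0) : ℝ)) ^ (-σ) *
        ∏ i : Fin 3, (max 1 ((normAbs (v.adicCompletion ↥(maximalRealSubfield L)) (p i) : ℝ≥0) : ℝ)) ^ (-(2 * (σ / 3))) := by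
  haveI : Algebra.IsQuadraticExtension ↥(maximalRealSubfield L) L := IsCMField.isQuadraticExtension L
  haveI : Subsingleton (PlacesOver L v) := PlacesOver.subsingleton_of_smul_eq (IsCMField.complexConj L) (IsCMField.complexConj_ne_one L) w hw
  rw [Fintype.prod_subsingleton _ w]
  -- abbreviations (as reals)
  set n2 : ℝ := ((normAbs (v.adicCompletion ↥(maximalRealSubfield L)) 2 : ℝ≥0) : ℝ) with hn2
  set nδ : ℝ := ((normAbs (w.1.adicCompletion L) (algebraMap L (LocalRing L v) δ w) : ℝ≥0) : ℝ) with hnδ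
  set κ : ℝ := n2 ^ 2 * min 1 nδ with hκdef
  have hδw : (algebraMap L (LocalRing L v) δ) w ≠ 0 := by
    intro h0
    have : (algebraMap L (w.1.adicCompletion L) δ) = 0 := h0
    exact hδ ((map_eq_zero _).1 this)
  have hn2pos : 0 < n2 := by
    rw [hn2]; exact_mod_cast (pos_iff_ne_zero.2 ((map_ne_zero (normAbs (v.adicCompletion ↥(maximalRealSubfield L)))).2 two_ne_zero))
  have hnδpos : 0 < nδ := by
    rw [hnδ]; exact_mod_cast (pos_iff_ne_zero.2 ((map_ne_zero (normAbs (w.1.adicCompletion L))).2 hδw))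
  have hκ : 0 < κ := mul_pos (pow_pos hn2pos 2) (lt_min one_pos hnδpos)
  have hκcast : ((normAbs (v.adicCompletion ↥(maximalRealSubfield L)) 2 ^ 2 * min 1 (normAbs (w.1.adicCompletion L) (algebraMap L (LocalRing L v) δ w)) : ℝ≥0) : ℝ) = κ := by
    rw [hκdef, hn2, hnδ]; push_cast; rfl
  rw [hκcast]
  -- the three lower bounds `Q ≥ max(1, κ‖p_i‖²)`
  set Q : ℝ := max 1 (max ((normAbs (w.1.adicCompletion L) (quadraticLocalEquiv L v (IsCMField.complexConj L) hcδ hδ (p 0, p 1) w) : ℝ≥0) : ℝ)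
      ((normAbs (w.1.adicCompletion L) ((toLocalRing L v (p 2) * algebraMap L (LocalRing L v) δ -
        toLocalRing L v 2⁻¹ * (quadraticLocalEquiv L v (IsCMField.complexConj L) hcδ hδ (p 0, p 1) *
          conjLocal L (IsCMField.complexConj L) v (quadraticLocalEquiv L v (IsCMField.complexConj L) hcδ hδ (p 0, p 1)))) w) : ℝ≥0) : ℝ)) with hQ
  obtain ⟨hXa, hXb⟩ := normAbs_quadraticLocalEquiv_lower L hcδ hδ v w hw (p 0) (p 1)
  have hZt := normAbs_corner_lower L hcδ hδ v w hw (p 0) (p 1) (p 2)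
  have hκle1 : κ ≤ n2 ^ 2 := by rw [hκdef]; exact mul_le_of_le_one_right (sq_nonneg _) (min_le_left _ _)
  have hκle2 : κ ≤ n2 ^ 2 * nδ := by rw [hκdef]; exact mul_le_mul_of_nonneg_left (min_le_right _ _) (sq_nonneg _)
  have hb0 : Q ≥ max 1 (κ * ((normAbs (v.adicCompletion ↥(maximalRealSubfield L)) (p 0) : ℝ≥0) : ℝ) ^ 2) := by
    refine max_le (le_max_left _ _) (le_trans ?_ ((le_max_left _ _).trans (le_max_right _ _)))
    calc κ * ((normAbs (v.adicCompletion ↥(maximalRealSubfield L)) (p 0) : ℝ≥0) : ℝ) ^ 2 ≤ n2 ^ 2 * ((normAbs (v.adicCompletion ↥(maximalRealSubfield L)) (p 0) : ℝ≥0) : ℝ) ^ 2 :=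
          mul_le_mul_of_nonneg_right hκle1 (sq_nonneg _)
      _ ≤ _ := by rw [hn2]; exact_mod_cast hXa
  have hb1 : Q ≥ max 1 (κ * ((normAbs (v.adicCompletion ↥(maximalRealSubfield L)) (p 1) : ℝ≥0) : ℝ) ^ 2) := by
    refine max_le (le_max_left _ _) (le_trans ?_ ((le_max_left _ _).trans (le_max_right _ _)))
    calc κ * ((normAbs (v.adicCompletion ↥(maximalRealSubfield L)) (p 1) : ℝ≥0) : ℝ) ^ 2 ≤ n2 ^ 2 * nδ * ((normAbs (v.adicCompletion ↥(maximalRealSubfield L)) (p 1) : ℝ≥0) : ℝ) ^ 2 :=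
          mul_le_mul_of_nonneg_right hκle2 (sq_nonneg _)
      _ = n2 ^ 2 * ((normAbs (v.adicCompletion ↥(maximalRealSubfield L)) (p 1) : ℝ≥0) : ℝ) ^ 2 * nδ := by ring
      _ ≤ _ := by rw [hn2, hnδ]; exact_mod_cast hXb
  have hb2 : Q ≥ max 1 (κ * ((normAbs (v.adicCompletion ↥(maximalRealSubfield L)) (p 2) : ℝ≥0) : ℝ) ^ 2) := by
    refine max_le (le_max_left _ _) (le_trans ?_ ((le_max_right _ _).trans (le_max_right _ _)))
    calc κ * ((normAbs (v.adicCompletion ↥(maximalRealSubfield L)) (p 2) : ℝ≥0) : ℝ) ^ 2 ≤ n2 ^ 2 * nδ * ((normAbs (v.adicCompletion ↥(maximalRealSubfield L)) (p 2) : ℝ≥0) : ℝ) ^ 2 :=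
          mul_le_mul_of_nonneg_right hκle2 (sq_nonneg _)
      _ = n2 ^ 2 * ((normAbs (v.adicCompletion ↥(maximalRealSubfield L)) (p 2) : ℝ≥0) : ℝ) ^ 2 * nδ := by ring
      _ ≤ _ := by rw [hn2, hnδ]; exact_mod_cast hZt
  -- `Q^{−σ} = (Q³)^{−σ/3} ≤ (∏ max(1, κ‖p_i‖²))^{−σ/3} = ∏ max(1,κ‖p_i‖²)^{−σ/3} ≤ ∏ min(1,κ)^{−σ/3}·max(1,‖p_i‖)^{−2σ/3}`
  have hQ1 : 1 ≤ Q := le_max_left _ _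
  have hm : ∀ i : Fin 3, (1 : ℝ) ≤ max 1 (κ * ((normAbs (v.adicCompletion ↥(maximalRealSubfield L)) (p i) : ℝ≥0) : ℝ) ^ 2) := fun i => le_max_left _ _
  have hprod : ∏ i : Fin 3, max 1 (κ * ((normAbs (v.adicCompletion ↥(maximalRealSubfield L)) (p i) : ℝ≥0) : ℝ) ^ 2) ≤ Q ^ (3 : ℕ) := by
    rw [Fin.prod_univ_three, show Q ^ (3 : ℕ) = Q * Q * Q by ring]
    exact mul_le_mul (mul_le_mul hb0 hb1 (zero_le_one.trans (hm 1)) (zero_le_one.trans hQ1)) hb2 (zero_le_one.trans (hm 2)) (by positivity)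
  have hstep : Q ^ (-σ) ≤ (∏ i : Fin 3, max 1 (κ * ((normAbs (v.adicCompletion ↥(maximalRealSubfield L)) (p i) : ℝ≥0) : ℝ) ^ 2)) ^ (-(σ / 3)) := by
    have h3 : Q ^ (-σ) = (Q ^ (3 : ℕ)) ^ (-(σ / 3)) := by
      rw [← Real.rpow_natCast, ← Real.rpow_mul (zero_le_one.trans hQ1)]
      congr 1
      push_cast
      ring
    rw [h3]
    exact Real.rpow_le_rpow_of_nonpos (Finset.prod_pos fun i _ => lt_of_lt_of_le one_pos (hm i)) hprod (by linarith)
  refine hstep.trans ?_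
  rw [← Real.finsetProd_rpow _ _ (fun i _ => (zero_le_one.trans (hm i)))]
  have hterm : ∀ i : Fin 3, (max 1 (κ * ((normAbs (v.adicCompletion ↥(maximalRealSubfield L)) (p i) : ℝ≥0) : ℝ) ^ 2)) ^ (-(σ / 3)) ≤
      (min 1 κ) ^ (-(σ / 3)) * (max 1 ((normAbs (v.adicCompletion ↥(maximalRealSubfield L)) (p i) : ℝ≥0) : ℝ)) ^ (-(2 * (σ / 3))) := fun i =>
    max_one_mul_sq_rpow_neg_le hκ (by linarith)
  calc ∏ i : Fin 3, (max 1 (κ * ((normAbs (v.adicCompletion ↥(maximalRealSubfield L)) (p i) : ℝ≥0) : ℝ) ^ 2)) ^ (-(σ / 3))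
      ≤ ∏ i : Fin 3, (min 1 κ) ^ (-(σ / 3)) * (max 1 ((normAbs (v.adicCompletion ↥(maximalRealSubfield L)) (p i) : ℝ≥0) : ℝ)) ^ (-(2 * (σ / 3))) :=
        Finset.prod_le_prod (fun i _ => Real.rpow_nonneg (zero_le_one.trans (hm i)) _) fun i _ => hterm i
    _ = (min 1 κ) ^ (-σ) * ∏ i : Fin 3, (max 1 ((normAbs (v.adicCompletion ↥(maximalRealSubfield L)) (p i) : ℝ≥0) : ℝ)) ^ (-(2 * (σ / 3))) := by
        rw [Finset.prod_mul_distrib, Finset.prod_const, Finset.card_univ, Fintype.card_fin, ← Real.rpow_natCast, ← Real.rpow_mul (lt_min one_pos hκ).le]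
        congr 2
        push_cast
        ring

/-! ## §4 The CM pair: non-split places (`σ > 3∕2`, any badness) and every place -/

/-- **INTEGRABILITY OF `Q_v^{−σ}` AT A NON-SPLIT PLACE, NO GOODNESS HYPOTHESIS** (`σ > 3∕2`): §3's majorant is a product of one-variable integrable functions
(★ `integrable_max_one_normAbs_rpow_neg` at `s = 2σ∕3 > 1`, `Integrable.fintype_prod`); measurability ★ `continuous_localHeight_rpow`. [cite: TateThesis1967, §3.3] [cite: MoeglinWaldspurger1995, II.1.7] -/
theorem integrable_localHeight_rpow_of_nonsplit_cm (w : PlacesOver L v) (hw : IsCMField.complexConj L • w.1 = w.1) {σ : ℝ} (hσ : 3 / 2 < σ) :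
    Integrable (fun p : Fin 3 → v.adicCompletion ↥(maximalRealSubfield L) =>
        (∏ w' : PlacesOver L v, max 1 (max ((normAbs (w'.1.adicCompletion L) (quadraticLocalEquiv L v (IsCMField.complexConj L) hcδ hδ (p 0, p 1) w') : ℝ≥0) : ℝ)
          ((normAbs (w'.1.adicCompletion L) ((toLocalRing L v (p 2) * algebraMap L (LocalRing L v) δ -
            toLocalRing L v 2⁻¹ * (quadraticLocalEquiv L v (IsCMField.complexConj L) hcδ hδ (p 0, p 1) *
              conjLocal L (IsCMField.complexConj L) v (quadraticLocalEquiv L v (IsCMField.complexConj L) hcδ hδ (p 0, p 1)))) w') : ℝ≥0) : ℝ))) ^ (-σ))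
      (Measure.pi fun _ : Fin 3 => ν) := by
  haveI : Algebra.IsQuadraticExtension ↥(maximalRealSubfield L) L := IsCMField.isQuadraticExtension L
  haveI := secondCountableTopology_localField (v.adicCompletion ↥(maximalRealSubfield L)); haveI := sigmaCompactSpace_of_isNonarchimedeanLocalField (v.adicCompletion ↥(maximalRealSubfield L))
  have hs : 1 < 2 * (σ / 3) := by linarith
  have hmaj : Integrable (fun p : Fin 3 → v.adicCompletion ↥(maximalRealSubfield L) =>
      (min 1 ((normAbs (v.adicCompletion ↥(maximalRealSubfield L)) 2 ^ 2 * min 1 (normAbs (w.1.adicCompletion L) (algebraMap L (LocalRing L v) δ w)) : ℝ≥0) : ℝ)) ^ (-σ) *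
        ∏ i : Fin 3, (max 1 ((normAbs (v.adicCompletion ↥(maximalRealSubfield L)) (p i) : ℝ≥0) : ℝ)) ^ (-(2 * (σ / 3)))) (Measure.pi fun _ : Fin 3 => ν) :=
    (Integrable.fintype_prod (f := fun (_ : Fin 3) (y : v.adicCompletion ↥(maximalRealSubfield L)) => (max 1 ((normAbs (v.adicCompletion ↥(maximalRealSubfield L)) y : ℝ≥0) : ℝ)) ^ (-(2 * (σ / 3))))
      fun _ => integrable_max_one_normAbs_rpow_neg ν hs).const_mul _
  refine hmaj.mono' (continuous_localHeight_rpow L (IsCMField.complexConj L) hcδ hδ v σ).aestronglyMeasurable (Filter.Eventually.of_forall fun p => ?_)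
  rw [Real.norm_of_nonneg (Real.rpow_nonneg (Finset.prod_nonneg fun w' _ => zero_le_one.trans (le_max_left _ _)) _)]
  exact localHeight_rpow_le_of_nonsplit L hcδ hδ v w hw (by linarith) p

include hd in
/-- **HEAD (β).  `Q_v^{−σ} ∈ L¹(ν_v³)` AT EVERY FINITE PLACE `v` OF `L⁺` FOR `σ > 3∕2`** — split (§2, `σ > 1`) or non-split (§4); no hypothesis on `v` (the places `v ∣ 2`, `v` ramified in `L`,
`δ` a non-unit — the set `S₀` of ★ FILE 3′ — included), in particular AT THE POLE `σ = 2`. [cite: Langlands1971, §3] [cite: MoeglinWaldspurger1995, II.1.7] [cite: TateThesis1967, §3.3] -/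
theorem integrable_localHeight_rpow_cm {σ : ℝ} (hσ : 3 / 2 < σ) :
    Integrable (fun p : Fin 3 → v.adicCompletion ↥(maximalRealSubfield L) =>
        (∏ w' : PlacesOver L v, max 1 (max ((normAbs (w'.1.adicCompletion L) (quadraticLocalEquiv L v (IsCMField.complexConj L) hcδ hδ (p 0, p 1) w') : ℝ≥0) : ℝ)
          ((normAbs (w'.1.adicCompletion L) ((toLocalRing L v (p 2) * algebraMap L (LocalRing L v) δ -
            toLocalRing L v 2⁻¹ * (quadraticLocalEquiv L v (IsCMField.complexConj L) hcδ hδ (p 0, p 1) *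
              conjLocal L (IsCMField.complexConj L) v (quadraticLocalEquiv L v (IsCMField.complexConj L) hcδ hδ (p 0, p 1)))) w') : ℝ≥0) : ℝ))) ^ (-σ))
      (Measure.pi fun _ : Fin 3 => ν) := by
  obtain ⟨w⟩ := PlacesOver.nonempty L v
  by_cases hw : IsCMField.complexConj L • w.1 = w.1
  · exact integrable_localHeight_rpow_of_nonsplit_cm L hcδ hδ v ν w hw hσ
  · exact integrable_localHeight_rpow_of_split_cm L hcδ hδ hd v ν w hw (by linarith)

include hd in
/-- **THE `σ`-UNIFORM LOCAL BOUND, `ℂ`-CURRENCY** (the pay-out's currency, ★ FILE 3′'s `v`-factor verbatim): for `3∕2 < σ₀ ≤ σ`,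
`‖(ν³(𝒪_v³))⁻¹ • ∫ ((Q_v^{−σ} : ℝ) : ℂ) dν³‖ ≤ (ν³(𝒪_v³))⁻¹ · ∫ Q_v^{−σ₀} dν³` (`Q_v ≥ 1`, so `Q_v^{−σ} ≤ Q_v^{−σ₀}`, integrable by the head). [cite: MoeglinWaldspurger1995, II.1.7] -/
theorem norm_localMean_le_cm {σ₀ σ : ℝ} (hσ₀ : 3 / 2 < σ₀) (hσ : σ₀ ≤ σ) :
    ‖((Measure.pi fun _ : Fin 3 => ν) (integralBox ↥(maximalRealSubfield L) (Fin 3) v)).toReal⁻¹ •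
        ∫ p : Fin 3 → v.adicCompletion ↥(maximalRealSubfield L),
          (((∏ w' : PlacesOver L v, max 1 (max ((normAbs (w'.1.adicCompletion L) (quadraticLocalEquiv L v (IsCMField.complexConj L) hcδ hδ (p 0, p 1) w') : ℝ≥0) : ℝ)
            ((normAbs (w'.1.adicCompletion L) ((toLocalRing L v (p 2) * algebraMap L (LocalRing L v) δ -
              toLocalRing L v 2⁻¹ * (quadraticLocalEquiv L v (IsCMField.complexConj L) hcδ hδ (p 0, p 1) *
                conjLocal L (IsCMField.complexConj L) v (quadraticLocalEquiv L v (IsCMField.complexConj L) hcδ hδ (p 0, p 1)))) w') : ℝ≥0) : ℝ))) ^ (-σ) : ℝ) : ℂ)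
          ∂(Measure.pi fun _ : Fin 3 => ν)‖ ≤
      ((Measure.pi fun _ : Fin 3 => ν) (integralBox ↥(maximalRealSubfield L) (Fin 3) v)).toReal⁻¹ *
        ∫ p : Fin 3 → v.adicCompletion ↥(maximalRealSubfield L),
          (∏ w' : PlacesOver L v, max 1 (max ((normAbs (w'.1.adicCompletion L) (quadraticLocalEquiv L v (IsCMField.complexConj L) hcδ hδ (p 0, p 1) w') : ℝ≥0) : ℝ)
            ((normAbs (w'.1.adicCompletion L) ((toLocalRing L v (p 2) * algebraMap L (LocalRing L v) δ -
              toLocalRing L v 2⁻¹ * (quadraticLocalEquiv L v (IsCMField.complexConj L) hcδ hδ (p 0, p 1) *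
                conjLocal L (IsCMField.complexConj L) v (quadraticLocalEquiv L v (IsCMField.complexConj L) hcδ hδ (p 0, p 1)))) w') : ℝ≥0) : ℝ))) ^ (-σ₀)
          ∂(Measure.pi fun _ : Fin 3 => ν) := by
  have hint := integrable_localHeight_rpow_cm L hcδ hδ hd v ν (lt_of_lt_of_le hσ₀ hσ)
  have hint₀ := integrable_localHeight_rpow_cm L hcδ hδ hd v ν hσ₀
  rw [norm_smul, norm_inv, Real.norm_of_nonneg ENNReal.toReal_nonneg, integral_complex_ofReal, Complex.norm_real]
  refine mul_le_mul_of_nonneg_left ((norm_integral_le_integral_norm _).trans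
    (integral_mono_of_nonneg (Filter.Eventually.of_forall fun p => norm_nonneg _) hint₀ (Filter.Eventually.of_forall fun p => ?_))) (inv_nonneg.2 ENNReal.toReal_nonneg)
  have h1 : (1 : ℝ) ≤ ∏ w' : PlacesOver L v, max 1 (max ((normAbs (w'.1.adicCompletion L) (quadraticLocalEquiv L v (IsCMField.complexConj L) hcδ hδ (p 0, p 1) w') : ℝ≥0) : ℝ)
      ((normAbs (w'.1.adicCompletion L) ((toLocalRing L v (p 2) * algebraMap L (LocalRing L v) δ -
        toLocalRing L v 2⁻¹ * (quadraticLocalEquiv L v (IsCMField.complexConj L) hcδ hδ (p 0, p 1) *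
          conjLocal L (IsCMField.complexConj L) v (quadraticLocalEquiv L v (IsCMField.complexConj L) hcδ hδ (p 0, p 1)))) w') : ℝ≥0) : ℝ)) :=
    Finset.one_le_prod fun w' _ => le_max_left _ _
  simp only
  rw [Real.norm_of_nonneg (Real.rpow_nonneg (zero_le_one.trans h1) _)]
  exact Real.rpow_le_rpow_of_exponent_le h1 (neg_le_neg hσ)

end Places

end Summit.HodgeConjecture.HodgeConjecture.Cruxes.H413.K2E1IntertwiningLocalFactorIntegrableU3

end
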